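import Summits.ValiantsHypothesis.ValiantsHypothesis.Theorems.SliceSignRankSrkNotQPForsterSliceIsotropic

/-!
# Route SliceSignRank — crux `SrkNotQP` (stmt-ValiantsHypothesis-20857), line `forster_slice`:
# the single ISOTROPY CONSTANT form of Forster's inequality for the slice

Sequel to `SliceSignRankSrkNotQPForsterSliceIsotropic` (p582178).  There the verbatim Forster
argument was run under two hypotheses, an `L²` isotropy defect `B` and a sup-flatness defect
`B'`.  Forster's three lines in fact consume ONE number attached to a sign-representation
`F(σ) = Σ_{t<k} φ_t(σ)`, `φ_t(σ) = Π_i W_t(σ i, i)`, of `sgn` on `S_n`: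

  `K(W) := n! · (Σ_t ‖φ_t‖²) / ‖F‖₁²  =  n! · Σ_t per(W_t ∘ W_t) / (Σ_σ |F(σ)|)²`,

the **isotropy constant** (term mass over squared total mass; `‖F‖₁ = Σ_t det W_t` by p1's
dictionary).  THEOREM (`forsterSlice_of_isotropyConstant`): some term `V = W_t` has `det V ≠ 0` and

  `n! · per(V ∘ V) ≤ K · k · det(V)²`,

and hence (`factorial_sq_le_of_isotropyConstant`, with the landed van der Waerden–Hadamard bound)
`k · K ≥ (n!)²/nⁿ`.  Calibration: in Forster's matrix setting (unit vectors in isotropic position)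
`K = k` exactly (`‖A‖_F² = N²/k = Σ_i ‖a⁽ⁱ⁾⊗b⁽ⁱ⁾‖²`, `‖A‖₁ ≥ ‖A‖_F²`), reproducing his exponent
`C = 2`; `K ≤ B · B₂ ≤ B · B'` where `B₂ = n!‖F‖₂²/‖F‖₁² ≤ B'` is the `L²/L¹` flatness
(`termMass_le_of_iso_flatL1`, `flatL1_of_flat`), so this form implies the two-constant theorem;
Leibniz (`k = n!`) and the `n = 2` Hadamard twist have `K = 1` with equality.

NUMERICAL CENSUS (local search, folder `census/` of seat val-width-20857-p2; evidence on the item):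
(near-)optimal short representations have `K ≈ 0.97 (n=3,k=2)`, `1.40 (n=4,k=2; integer witness
W₀ = [[1,−2,1,2],[2,1,−2,1],[−2,1,−1,2],[−1,−2,−2,−1]], W₁ = [[2,1,−2,−1],[1,−2,1,−2],[1,2,2,−1],
[−2,1,−1,−2]], F ∈ {±6,±8,±17})`, `1.89 (n=5,k=4)` — all BELOW Forster's `K = k`.  DICHOTOMY this
theorem sets up for the crux: either `K/k` stays bounded along optimal representations (then
`srk(n) ≥ n!/n^{n/2}` up to constants — the stub with `C = 2`), or short representations for large
`n` are necessarily violently non-isotropic, `K ≥ (n!)²/(nⁿ k²)` — the "cancellations help"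
mechanism of the crux's `why_might_fail`, quantified.  Nothing here decides which; the stub,
`SrkNotQP` and `SignRankSuperQP` stay OPEN; `VP ≠ VNP` is not touched.  Landed `--supports
stmt-ValiantsHypothesis-20857` (helper).

References: [Forster2002] Thm 2.2 (Jukna 2012, Thm 4.42); [RazborovSherstov2010] §1.
-/

-- Sub = Summit layout duplicates the namespace component
set_option linter.dupNamespace false

namespace Summit.ValiantsHypothesis.ValiantsHypothesis.Theorems.SliceSignRank.SrkNotQP

open Finset Equiv

/-! ## §1 Picking a twist by ratio of sums -/

/-- **Ratio of sums picks a twist.**  If `Σ_t n! · per(W_t ∘ W_t) ≤ Σ_t L · det(W_t)²` for a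
sign-representation, then some `t` with `det W_t ≠ 0` has `n! · per(W_t ∘ W_t) ≤ L · det(W_t)²`
(restrict both sums to `{t : det W_t ≠ 0}` — nonempty by p1's `exists_det_ge_of_signRep` — and
compare termwise). [this file] -/
theorem exists_twist_of_sum_le {n k : ℕ} (W : Fin k → Matrix (Fin n) (Fin n) ℝ) (L : ℝ)
    (hrep : ∀ σ : Perm (Fin n), 0 < ((Perm.sign σ : ℤ) : ℝ) * ∑ t, ∏ i, W t (σ i) i)
    (h : ∑ t, (n.factorial : ℝ) * (Matrix.of fun i j => W t i j ^ 2).permanent ≤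
      ∑ t, L * (W t).det ^ 2) :
    ∃ t : Fin k, (W t).det ≠ 0 ∧
      (n.factorial : ℝ) * (Matrix.of fun i j => W t i j ^ 2).permanent ≤ L * (W t).det ^ 2 := by
  have hfac : (0 : ℝ) ≤ n.factorial := Nat.cast_nonneg _
  set T : Finset (Fin k) := Finset.univ.filter (fun t => (W t).det ≠ 0) with hT
  obtain ⟨t₀, -, hdet₀⟩ := exists_det_ge_of_signRep W hrep
  have hTne : T.Nonempty := ⟨t₀, by simp [hT, hdet₀.ne']⟩
  have hsumQ : ∑ t ∈ T, L * (W t).det ^ 2 = ∑ t, L * (W t).det ^ 2 := by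
    refine Finset.sum_filter_of_ne fun t _ ht => ?_
    intro hdet
    apply ht
    simp [hdet]
  have hsumP : ∑ t ∈ T, (n.factorial : ℝ) * (Matrix.of fun i j => W t i j ^ 2).permanent ≤
      ∑ t, (n.factorial : ℝ) * (Matrix.of fun i j => W t i j ^ 2).permanent :=
    Finset.sum_le_sum_of_subset_of_nonneg (Finset.filter_subset _ _)
      fun t _ _ => mul_nonneg hfac (permanent_sq_nonneg (W t))
  have hle : ∑ t ∈ T, (n.factorial : ℝ) * (Matrix.of fun i j => W t i j ^ 2).permanent ≤
      ∑ t ∈ T, L * (W t).det ^ 2 := by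
    rw [hsumQ]; exact hsumP.trans h
  obtain ⟨t, htT, ht⟩ := Finset.exists_le_of_sum_le hTne hle
  exact ⟨t, (Finset.mem_filter.mp htT).2, ht⟩

/-- The total mass `Σ_σ |F(σ)|` of a sign-representation is positive. [folklore] -/
theorem sum_abs_pos_of_signRep {n k : ℕ} (W : Fin k → Matrix (Fin n) (Fin n) ℝ)
    (hrep : ∀ σ : Perm (Fin n), 0 < ((Perm.sign σ : ℤ) : ℝ) * ∑ t, ∏ i, W t (σ i) i) :
    0 < ∑ σ : Perm (Fin n), |∑ t, ∏ i, W t (σ i) i| := by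
  have h1 : 0 < |∑ t, ∏ i, W t ((1 : Perm (Fin n)) i) i| := by
    rw [abs_eq_sign_mul_of_pos 1 _ (hrep 1)]; exact hrep 1
  exact lt_of_lt_of_le h1 (Finset.single_le_sum
    (f := fun σ : Perm (Fin n) => |∑ t, ∏ i, W t (σ i) i|) (fun σ _ => abs_nonneg _)
    (Finset.mem_univ (1 : Perm (Fin n))))

/-! ## §2 Forster's inequality from the isotropy constant -/

/-- **Forster's inequality for the permutation slice — isotropy-constant form.**  Let
`F = Σ_{t<k} φ_t` (`φ_t(σ) = Π_i W_t(σ i, i)`) sign-represent `sgn` on `S_n` and suppose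
`n! · Σ_t per(W_t ∘ W_t) ≤ K · (Σ_σ |F(σ)|)²` (isotropy constant at most `K`; Forster's isotropic
position: `K = k`; Leibniz: `K = 1`).  Then some term has `det W_t ≠ 0` and
`n! · per(W_t ∘ W_t) ≤ K · k · det(W_t)²`.  Proof: `Σ_σ |F| = Σ_t det W_t`
(p1's `sum_abs_eq_sum_det`), Cauchy–Schwarz `(Σ_t det W_t)² ≤ k Σ_t det(W_t)²`, ratio of sums.
The stub itself (no isotropy hypothesis) remains OPEN.
[this file; pattern of Forster2002 Thm 2.2] -/
theorem forsterSlice_of_isotropyConstant (n k : ℕ) (W : Fin k → Matrix (Fin n) (Fin n) ℝ) (K : ℝ)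
    (hrep : ∀ σ : Perm (Fin n), 0 < ((Perm.sign σ : ℤ) : ℝ) * ∑ t, ∏ i, W t (σ i) i)
    (hK : (n.factorial : ℝ) * ∑ t, (Matrix.of fun i j => W t i j ^ 2).permanent ≤
      K * (∑ σ : Perm (Fin n), |∑ t, ∏ i, W t (σ i) i|) ^ 2) :
    ∃ t : Fin k, (W t).det ≠ 0 ∧
      (n.factorial : ℝ) * (Matrix.of fun i j => W t i j ^ 2).permanent ≤
        K * (k : ℝ) * (W t).det ^ 2 := by
  set P : ℝ := ∑ t, (Matrix.of fun i j => W t i j ^ 2).permanent with hP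
  set D : ℝ := ∑ t, (W t).det with hD
  have hTD : ∑ σ : Perm (Fin n), |∑ t, ∏ i, W t (σ i) i| = D := sum_abs_eq_sum_det W hrep
  have hDpos : 0 < D := hTD ▸ sum_abs_pos_of_signRep W hrep
  have hfac : (0 : ℝ) ≤ n.factorial := Nat.cast_nonneg _
  have hPnn : 0 ≤ P := Finset.sum_nonneg fun t _ => permanent_sq_nonneg (W t)
  rw [hTD] at hK
  -- `K ≥ 0` since `0 ≤ n! P ≤ K D²` and `D² > 0`
  have hK0 : 0 ≤ K := by
    refine le_of_mul_le_mul_right ?_ (pow_pos hDpos 2)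
    rw [zero_mul]
    exact (mul_nonneg hfac hPnn).trans hK
  -- `n! P ≤ K D² ≤ K k Q`
  have h1 : (n.factorial : ℝ) * P ≤ K * (k : ℝ) * ∑ t, (W t).det ^ 2 :=
    calc (n.factorial : ℝ) * P ≤ K * D ^ 2 := hK
      _ ≤ K * ((k : ℝ) * ∑ t, (W t).det ^ 2) := mul_le_mul_of_nonneg_left (sq_sum_det_le W) hK0
      _ = K * (k : ℝ) * ∑ t, (W t).det ^ 2 := by ring
  refine exists_twist_of_sum_le W (K * (k : ℝ)) hrep ?_
  rw [← Finset.mul_sum, ← Finset.mul_sum]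
  exact h1

/-- **Stub shape**: a polynomial isotropy constant `K ≤ k^a` gives the conclusion of
`stub_forsterSlice` with exponent `C = a + 1` (Forster: `a = 1`, `C = 2`). [this file] -/
theorem forsterSlice_of_isotropyConstant_pow (n k a : ℕ) (W : Fin k → Matrix (Fin n) (Fin n) ℝ)
    (K : ℝ) (hKk : K ≤ (k : ℝ) ^ a)
    (hrep : ∀ σ : Perm (Fin n), 0 < ((Perm.sign σ : ℤ) : ℝ) * ∑ t, ∏ i, W t (σ i) i)
    (hK : (n.factorial : ℝ) * ∑ t, (Matrix.of fun i j => W t i j ^ 2).permanent ≤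
      K * (∑ σ : Perm (Fin n), |∑ t, ∏ i, W t (σ i) i|) ^ 2) :
    ∃ V : Matrix (Fin n) (Fin n) ℝ, V.det ≠ 0 ∧
      (n.factorial : ℝ) * (Matrix.of fun i j => V i j ^ 2).permanent ≤
        (k : ℝ) ^ (a + 1) * V.det ^ 2 := by
  obtain ⟨t, hdet, ht⟩ := forsterSlice_of_isotropyConstant n k W K hrep hK
  refine ⟨W t, hdet, ht.trans (mul_le_mul_of_nonneg_right ?_ (sq_nonneg _))⟩
  have hk0 : (0 : ℝ) ≤ k := Nat.cast_nonneg k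
  calc K * (k : ℝ) ≤ (k : ℝ) ^ a * (k : ℝ) := mul_le_mul_of_nonneg_right hKk hk0
    _ = (k : ℝ) ^ (a + 1) := by ring

/-! ## §3 The isotropy constant is at most `B · B₂ ≤ B · B'` -/

/-- **Term mass from isotropy defect and `L²/L¹` flatness**: (I1) `Σ_t per(W_t∘W_t) ≤ B·‖F‖₂²` and
(I2₂) `n!·‖F‖₂² ≤ B₂·‖F‖₁²` give the isotropy-constant hypothesis with `K = B · B₂`. [this file] -/
theorem termMass_le_of_iso_flatL1 {n k : ℕ} (W : Fin k → Matrix (Fin n) (Fin n) ℝ) (B B₂ : ℝ)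
    (hrep : ∀ σ : Perm (Fin n), 0 < ((Perm.sign σ : ℤ) : ℝ) * ∑ t, ∏ i, W t (σ i) i)
    (hiso : ∑ t, (Matrix.of fun i j => W t i j ^ 2).permanent ≤
      B * ∑ σ : Perm (Fin n), (∑ t, ∏ i, W t (σ i) i) ^ 2)
    (hflat₁ : (n.factorial : ℝ) * ∑ σ : Perm (Fin n), (∑ t, ∏ i, W t (σ i) i) ^ 2 ≤
      B₂ * (∑ σ : Perm (Fin n), |∑ t, ∏ i, W t (σ i) i|) ^ 2) :
    (n.factorial : ℝ) * ∑ t, (Matrix.of fun i j => W t i j ^ 2).permanent ≤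
      (B * B₂) * (∑ σ : Perm (Fin n), |∑ t, ∏ i, W t (σ i) i|) ^ 2 := by
  have hB : 0 ≤ B := isoDefect_nonneg W B hrep hiso
  have hfac : (0 : ℝ) ≤ n.factorial := Nat.cast_nonneg _
  calc (n.factorial : ℝ) * ∑ t, (Matrix.of fun i j => W t i j ^ 2).permanent
      ≤ (n.factorial : ℝ) * (B * ∑ σ : Perm (Fin n), (∑ t, ∏ i, W t (σ i) i) ^ 2) :=
        mul_le_mul_of_nonneg_left hiso hfac
    _ = B * ((n.factorial : ℝ) * ∑ σ : Perm (Fin n), (∑ t, ∏ i, W t (σ i) i) ^ 2) := by ring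
    _ ≤ B * (B₂ * (∑ σ : Perm (Fin n), |∑ t, ∏ i, W t (σ i) i|) ^ 2) :=
        mul_le_mul_of_nonneg_left hflat₁ hB
    _ = (B * B₂) * (∑ σ : Perm (Fin n), |∑ t, ∏ i, W t (σ i) i|) ^ 2 := by ring

/-- **Sup-flatness implies `L²/L¹` flatness**: (I2) `n!·F(σ)² ≤ B'·‖F‖₂²` for all `σ` gives
`n!·‖F‖₂² ≤ B'·‖F‖₁²` (`‖F‖₂² ≤ max|F| · ‖F‖₁`, square, and use (I2) at the maximiser). So the
two-constant theorem `forsterSlice_of_isotropic` is the case `K = B · B'` of this file.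
[this file] -/
theorem flatL1_of_flat {n k : ℕ} (W : Fin k → Matrix (Fin n) (Fin n) ℝ) (B' : ℝ)
    (hrep : ∀ σ : Perm (Fin n), 0 < ((Perm.sign σ : ℤ) : ℝ) * ∑ t, ∏ i, W t (σ i) i)
    (hflat : ∀ σ : Perm (Fin n), (n.factorial : ℝ) * (∑ t, ∏ i, W t (σ i) i) ^ 2 ≤
      B' * ∑ τ : Perm (Fin n), (∑ t, ∏ i, W t (τ i) i) ^ 2) :
    (n.factorial : ℝ) * ∑ σ : Perm (Fin n), (∑ t, ∏ i, W t (σ i) i) ^ 2 ≤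
      B' * (∑ σ : Perm (Fin n), |∑ t, ∏ i, W t (σ i) i|) ^ 2 := by
  set F : Perm (Fin n) → ℝ := fun σ => ∑ t, ∏ i, W t (σ i) i with hF
  set S2 : ℝ := ∑ σ : Perm (Fin n), (F σ) ^ 2 with hS2
  set T : ℝ := ∑ σ : Perm (Fin n), |F σ| with hT
  have hS2pos : 0 < S2 := sum_sq_pos_of_signRep W hrep
  have hfac : (0 : ℝ) ≤ n.factorial := Nat.cast_nonneg _
  obtain ⟨σm, -, hσm⟩ := Finset.exists_max_image Finset.univ (fun σ => |F σ|)
    (Finset.univ_nonempty_iff.mpr ⟨(1 : Perm (Fin n))⟩)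
  set M : ℝ := |F σm| with hM
  have hM0 : 0 ≤ M := abs_nonneg _
  -- `S2 ≤ M · T`
  have h1 : S2 ≤ M * T := by
    rw [hS2, hT, Finset.mul_sum]
    refine Finset.sum_le_sum fun σ _ => ?_
    calc (F σ) ^ 2 = |F σ| * |F σ| := by rw [← sq_abs, sq]
      _ ≤ M * |F σ| := mul_le_mul_of_nonneg_right (hσm σ (Finset.mem_univ σ)) (abs_nonneg _)
  -- `n! M² ≤ B' S2`
  have h2 : (n.factorial : ℝ) * M ^ 2 ≤ B' * S2 := by
    have := hflat σm
    rwa [hM, sq_abs]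
  -- `n! S2² ≤ n! M² T² ≤ B' S2 T²`; cancel `S2 > 0`
  have hT0 : 0 ≤ T := Finset.sum_nonneg fun σ _ => abs_nonneg _
  have h3 : S2 ^ 2 ≤ M ^ 2 * T ^ 2 := by
    rw [← mul_pow]; exact pow_le_pow_left₀ hS2pos.le h1 2
  have h4 : S2 * ((n.factorial : ℝ) * S2) ≤ S2 * (B' * T ^ 2) :=
    calc S2 * ((n.factorial : ℝ) * S2) = (n.factorial : ℝ) * S2 ^ 2 := by ring
      _ ≤ (n.factorial : ℝ) * (M ^ 2 * T ^ 2) := mul_le_mul_of_nonneg_left h3 hfac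
      _ = ((n.factorial : ℝ) * M ^ 2) * T ^ 2 := by ring
      _ ≤ (B' * S2) * T ^ 2 := mul_le_mul_of_nonneg_right h2 (sq_nonneg _)
      _ = S2 * (B' * T ^ 2) := by ring
  exact le_of_mul_le_mul_left h4 hS2pos

/-! ## §4 Isotropic representations are long -/

/-- **Length lower bound from the isotropy constant.**  A `k`-term sign-representation of `sgn` on
`S_n` with isotropy constant at most `K` has `(n!)² ≤ nⁿ · K · k`, i.e. `k · K ≥ (n!)²/nⁿ`
(Forster-slice `n!·per ≤ K k det²` times van der Waerden–Hadamard `n!·det² ≤ nⁿ·per`, landed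
`stub_vdwHadamard`).  With Forster-type isotropy `K ≤ k` this would read `k ≥ n!/n^{n/2}`; whether
optimal representations stay isotropic is exactly what is open. [this file] -/
theorem factorial_sq_le_of_isotropyConstant (n k : ℕ) (W : Fin k → Matrix (Fin n) (Fin n) ℝ)
    (K : ℝ) (hrep : ∀ σ : Perm (Fin n), 0 < ((Perm.sign σ : ℤ) : ℝ) * ∑ t, ∏ i, W t (σ i) i)
    (hK : (n.factorial : ℝ) * ∑ t, (Matrix.of fun i j => W t i j ^ 2).permanent ≤
      K * (∑ σ : Perm (Fin n), |∑ t, ∏ i, W t (σ i) i|) ^ 2) :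
    (n.factorial : ℝ) ^ 2 ≤ (n : ℝ) ^ n * (K * (k : ℝ)) := by
  obtain ⟨t, hdet, h1⟩ := forsterSlice_of_isotropyConstant n k W K hrep hK
  have h2 := SignRankSuperQP.stub_vdwHadamard n (W t)
  set Pm : ℝ := (Matrix.of fun i j => W t i j ^ 2).permanent with hPm
  have hd : 0 < (W t).det ^ 2 := by positivity
  have hf : (0 : ℝ) ≤ n.factorial := Nat.cast_nonneg _
  have hn : (0 : ℝ) ≤ (n : ℝ) ^ n := by positivity
  have h5 : (n.factorial : ℝ) ^ 2 * (W t).det ^ 2 ≤ (n : ℝ) ^ n * (K * (k : ℝ)) * (W t).det ^ 2 :=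
    calc (n.factorial : ℝ) ^ 2 * (W t).det ^ 2
        = (n.factorial : ℝ) * ((n.factorial : ℝ) * (W t).det ^ 2) := by ring
      _ ≤ (n.factorial : ℝ) * ((n : ℝ) ^ n * Pm) := mul_le_mul_of_nonneg_left h2 hf
      _ = (n : ℝ) ^ n * ((n.factorial : ℝ) * Pm) := by ring
      _ ≤ (n : ℝ) ^ n * (K * (k : ℝ) * (W t).det ^ 2) := mul_le_mul_of_nonneg_left h1 hn
      _ = (n : ℝ) ^ n * (K * (k : ℝ)) * (W t).det ^ 2 := by ring
  exact le_of_mul_le_mul_right h5 hd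

end Summit.ValiantsHypothesis.ValiantsHypothesis.Theorems.SliceSignRank.SrkNotQP
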